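import Literature.Analysis.OperatorTheory.Enflo2023.FirstOrder
import HarnessLib

/-!
# Enflo 2023, v2 (28)–(30): the first-order coefficient identities at operator level

Source under adjudication: Per H. Enflo, *On the invariant subspace problem in Hilbert spaces*, arXiv:2305.15442 (v1
2023, v2 2024), bib key `Enflo2023` — a CLAIMED proof of the invariant subspace problem for operators on a separable
Hilbert space.  This file is part of the kernel-tight typing of the manuscript by the b2b-enflo repair cell
(formaliser 2, Part B: (28)–(47), the limiting argument and the final deduction).  It records what FOLLOWS (proved
implications from the manuscript's displayed hypotheses) and, where a step does not follow, the typed inference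
together with its refutation.  NOTHING here asserts that the manuscript's main theorem holds; no declaration concludes
the invariant subspace problem for an arbitrary operator.  Value (BLOCK-2b): theorems / refutations of typed
inferences about a text — not progress on the problem.

EnfloISP — Part B (formaliser 2).  v2 p.14 l.-6 – p.15, eqs. (28), (29), (30) and the `y ↦ (1+δ)y` rule
(tex L433–L476), AT OPERATOR LEVEL, kernel-checked.

Notation (paper pp.5–6, 14–15): `[ ] = I + V_yV_y^*`, `[ ]⁻¹ = \VV`, `z := [ ]⁻¹x₀`, `a_m = ⟨[ ]⁻¹x₀, T^m y⟩` ((17)),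
`b_m = ⟨[ ]⁻²x₀, T^m y⟩`, `κ_m = ⟨[ ]⁻¹y, T^m y⟩`.  Abstractly `W := V_y : E →L H` (`E = ℓ²`), and for ANY `u`,
`(W†u)_m = ⟨u, T^m y⟩` ((3)); so `W†z = (a_m)`, `W†([ ]⁻²x₀) = (b_m)`, `W†([ ]⁻¹y) = (κ_m)`, and `V_{T^jy} = W ∘ S^j =: W₁`
with `W₁†u = (⟨u, T^{m+j}y⟩)_m`, i.e. `W₁†z = (a_{m+j})_m`.  Dictionary: paper `⟨p, q⟩` (linear in `p`) = Mathlib `⟪q, p⟫_ℂ`.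

What is PROVED here (exact identities, no "first order" anywhere):
* `comp_adjoint_add_smul`:  (W + αW₁)(W + αW₁)† = WW† + B + |α|²W₁W₁†,  B := αW₁W† + ᾱWW₁†   — so `B` IS the
  first-order term of tex L455 and the remainder is displayed;  `comp_adjoint_one_add_smul`: ((1+δ)W)((1+δ)W)† =
  WW† + 2δWW† + δ²WW† (tex L435: first-order term `2δV_yV_y^*`).
* `inverse_comp_P_comp_inverse`:  [ ]⁻¹(WW†)[ ]⁻¹ = [ ]⁻¹ − [ ]⁻²  (tex L436, exact), and `P_apply_inverse`:
  (WW†)[ ]⁻¹x₀ = x₀ − [ ]⁻¹x₀ ((16): Σ a_mT^my = x₀ − [ ]⁻¹x₀), (WW†)[ ]⁻²x₀ = [ ]⁻¹x₀ − [ ]⁻²x₀ (tex L439–440).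
* `firstOrder_pairing`:  for self-adjoint `Binv` and any `u`:  ⟪u, Binv (B (Binv x₀))⟫ = α⟪W₁†(Binv u), W†z⟫ + ᾱ⟪W†(Binv u), W₁†z⟫.
  - u = x₀ (`eq28_pairing`, `eq28_pairing_re`): = α s + ᾱ s̄ = 2Re(αs), s = ⟪W₁†z, W†z⟫ = Σ_m ā_{m+j}a_m — with the sign
    from `firstOrder_inner_inverse` this is (28): the change of ⟨[ ]⁻¹x₀, x₀⟩ is −Σ(α a_m ā_{m+j} + ᾱ a_{m+j} ā_m).
  - u = z = [ ]⁻¹x₀ (`eq29_pairing`): = α⟪W₁†([ ]⁻²x₀), W†z⟫ + ᾱ⟪W†([ ]⁻²x₀), W₁†z⟫ = α Σ a_m b̄_{m+j} + ᾱ Σ a_{m+j} b̄_m —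
    (29) is `⟨ch [ ]⁻¹x₀, [ ]⁻¹x₀⟩ = −(that)`, the quantity entering (31)/(32).
  - u = y, together with the change `y ↦ y + αT^jy` in the second slot (`eq30_expansion`, exact with the single cross term
    `ᾱ⟪y₁, [ ]⁻¹B z⟫ = O(|α|²)` displayed): (30), including its `ᾱ a_j(1 − κ₀)` (the `m = 0` term of the second sum merged
    with `ᾱ a_j`; `κ₀` is real).
* `eq28`: the assembled statement — the Fréchet derivative of `S ↦ ⟨S⁻¹x₀, x₀⟩` at `S = [ ]` (FirstOrder.lean, Mathlib's
  `hasFDerivAt_ringInverse`) evaluated on `B` equals `−(α s + ᾱ s̄)`; `[ ]⁻¹` is self-adjoint (Mathlib `IsSelfAdjoint.ringInverse`).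
What remains informal: only the coefficient reading `(V_y†u)_m = ⟨u, T^m y⟩` (the `ℓ²`-instance, formaliser 1's
`PartA/Vy.lean`, pending), and — as everywhere in (28)–(45) — the manuscript's USE of first-order terms without remainders.
STATUS: CLOSED (zero sorry).
-/

open scoped InnerProductSpace ComplexConjugate
open ContinuousLinearMap

namespace Literature.Analysis.OperatorTheory.Enflo2023

variable {E H : Type*} [NormedAddCommGroup E] [InnerProductSpace ℂ E] [CompleteSpace E]
  [NormedAddCommGroup H] [InnerProductSpace ℂ H] [CompleteSpace H]

/-- The adjoint is conjugate-linear: `(W₀ + αW₁)† = W₀† + ᾱW₁†`. [folklore] -/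
lemma adjoint_add_smul (W₀ W₁ : E →L[ℂ] H) (α : ℂ) :
    adjoint (W₀ + α • W₁) = adjoint W₀ + conj α • adjoint W₁ := by
  rw [map_add, map_smulₛₗ]

/-- tex L455, EXACT: `(W + αW₁)(W + αW₁)† = WW† + (αW₁W† + ᾱWW₁†) + |α|²W₁W₁†`. [cite: Enflo2023, v2 (28)–(30), p.15] -/
theorem comp_adjoint_add_smul (W₀ W₁ : E →L[ℂ] H) (α : ℂ) :
    (W₀ + α • W₁) ∘L adjoint (W₀ + α • W₁)
      = W₀ ∘L adjoint W₀ + (α • (W₁ ∘L adjoint W₀) + conj α • (W₀ ∘L adjoint W₁))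
        + (α * conj α) • (W₁ ∘L adjoint W₁) := by
  rw [adjoint_add_smul]
  ext v
  simp only [ContinuousLinearMap.comp_apply, _root_.add_apply, _root_.smul_apply,
    map_add, map_smul, smul_add, smul_smul, mul_comm (conj α) α]
  abel

/-- tex L435, EXACT: `((1+δ)W)((1+δ)W)† = WW† + 2δWW† + δ²WW†` (first-order term `2δV_yV_y^*`). [cite: Enflo2023, v2 (28)–(30), p.15] -/
theorem comp_adjoint_one_add_smul (W₀ : E →L[ℂ] H) (δ : ℝ) :
    (((1 + δ : ℝ) : ℂ) • W₀) ∘L adjoint (((1 + δ : ℝ) : ℂ) • W₀)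
      = W₀ ∘L adjoint W₀ + ((2 * δ : ℝ) : ℂ) • (W₀ ∘L adjoint W₀) + ((δ ^ 2 : ℝ) : ℂ) • (W₀ ∘L adjoint W₀) := by
  rw [map_smulₛₗ]
  have hs : conj ((1 + δ : ℝ) : ℂ) * ((1 + δ : ℝ) : ℂ) = 1 + ((2 * δ : ℝ) : ℂ) + ((δ ^ 2 : ℝ) : ℂ) := by
    rw [Complex.conj_ofReal]; push_cast; ring
  ext v
  simp only [ContinuousLinearMap.comp_apply, _root_.add_apply, _root_.smul_apply,
    map_smul, smul_smul]
  rw [hs, add_smul, add_smul, one_smul]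

omit [CompleteSpace H] in
/-- tex L436/L439–440, EXACT: with `[ ] = 1 + P` a unit, `P[ ]⁻¹x = x − [ ]⁻¹x` ((16)) and
`P[ ]⁻²x = [ ]⁻¹x − [ ]⁻²x`. [cite: Enflo2023, v2 (28)–(30), p.15] -/
theorem P_apply_inverse (P : H →L[ℂ] H) (A : (H →L[ℂ] H)ˣ) (hA : (A : H →L[ℂ] H) = 1 + P) (x : H) :
    P ((↑A⁻¹ : H →L[ℂ] H) x) = x - (↑A⁻¹ : H →L[ℂ] H) x ∧
    P ((↑A⁻¹ : H →L[ℂ] H) ((↑A⁻¹ : H →L[ℂ] H) x)) = (↑A⁻¹ : H →L[ℂ] H) x - (↑A⁻¹ : H →L[ℂ] H) ((↑A⁻¹ : H →L[ℂ] H) x) := by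
  have hP : P = (A : H →L[ℂ] H) - 1 := by rw [hA]; abel
  have key : ∀ u : H, P ((↑A⁻¹ : H →L[ℂ] H) u) = u - (↑A⁻¹ : H →L[ℂ] H) u := fun u => by
    have h1 : (A : H →L[ℂ] H) ((↑A⁻¹ : H →L[ℂ] H) u) = u := by
      change ((A : H →L[ℂ] H) * (↑A⁻¹ : H →L[ℂ] H)) u = u
      rw [Units.mul_inv]; rfl
    rw [hP, _root_.sub_apply, h1]
    rfl
  exact ⟨key x, key _⟩

omit [CompleteSpace H] in
/-- tex L436, EXACT, operator form: `[ ]⁻¹ P [ ]⁻¹ = [ ]⁻¹ − [ ]⁻²` for `[ ] = 1 + P`. [cite: Enflo2023, v2 (28)–(30), p.15] -/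
theorem inverse_comp_P_comp_inverse (P : H →L[ℂ] H) (A : (H →L[ℂ] H)ˣ) (hA : (A : H →L[ℂ] H) = 1 + P) :
    (↑A⁻¹ : H →L[ℂ] H) * P * (↑A⁻¹ : H →L[ℂ] H) = (↑A⁻¹ : H →L[ℂ] H) - (↑A⁻¹ : H →L[ℂ] H) * (↑A⁻¹ : H →L[ℂ] H) := by
  have hP : P = (A : H →L[ℂ] H) - 1 := by rw [hA]; abel
  rw [hP, mul_sub, sub_mul, Units.inv_mul, one_mul, mul_one]

/-- The general pairing: for self-adjoint `Binv` (= `[ ]⁻¹`), `B = αW₁W₀† + ᾱW₀W₁†`, `z = Binv x₀` and ANY `u`,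
`⟪u, Binv (B z)⟫ = α⟪W₁†(Binv u), W₀†z⟫ + ᾱ⟪W₀†(Binv u), W₁†z⟫`. [cite: Enflo2023, v2 (28)–(30), p.15] -/
theorem firstOrder_pairing (Binv : H →L[ℂ] H) (hB : IsSelfAdjoint Binv) (W₀ W₁ : E →L[ℂ] H) (x₀ u : H) (α : ℂ) :
    ⟪u, Binv ((α • (W₁ ∘L adjoint W₀) + conj α • (W₀ ∘L adjoint W₁)) (Binv x₀))⟫_ℂ
      = α * ⟪adjoint W₁ (Binv u), adjoint W₀ (Binv x₀)⟫_ℂ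
        + conj α * ⟪adjoint W₀ (Binv u), adjoint W₁ (Binv x₀)⟫_ℂ := by
  have hsa : ∀ v, ⟪u, Binv v⟫_ℂ = ⟪Binv u, v⟫_ℂ := fun v => by
    rw [← adjoint_inner_left, hB.adjoint_eq]
  rw [hsa]
  simp only [_root_.add_apply, _root_.smul_apply, ContinuousLinearMap.comp_apply,
    inner_add_right, inner_smul_right]
  rw [← adjoint_inner_left W₁, ← adjoint_inner_left W₀ (adjoint W₁ (Binv x₀))]

/-- **(28), the pairing** (`u = x₀`): `⟨[ ]⁻¹B[ ]⁻¹x₀, x₀⟩ = α·s + ᾱ·s̄`, `s = ⟪W₁†z, W₀†z⟫` (paper: `Σ_m a_m ā_{m+j}`). [cite: Enflo2023, v2 (28)–(30), p.15] -/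
theorem eq28_pairing (Binv : H →L[ℂ] H) (hB : IsSelfAdjoint Binv) (W₀ W₁ : E →L[ℂ] H) (x₀ : H) (α : ℂ) :
    ⟪x₀, Binv ((α • (W₁ ∘L adjoint W₀) + conj α • (W₀ ∘L adjoint W₁)) (Binv x₀))⟫_ℂ
      = α * ⟪adjoint W₁ (Binv x₀), adjoint W₀ (Binv x₀)⟫_ℂ
        + conj α * conj ⟪adjoint W₁ (Binv x₀), adjoint W₀ (Binv x₀)⟫_ℂ := by
  rw [firstOrder_pairing Binv hB, inner_conj_symm]

/-- (28) is a real number: the pairing equals `2 Re(α s)`. [cite: Enflo2023, v2 (28)–(30), p.15] -/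
theorem eq28_pairing_re (Binv : H →L[ℂ] H) (hB : IsSelfAdjoint Binv) (W₀ W₁ : E →L[ℂ] H) (x₀ : H) (α : ℂ) :
    ⟪x₀, Binv ((α • (W₁ ∘L adjoint W₀) + conj α • (W₀ ∘L adjoint W₁)) (Binv x₀))⟫_ℂ
      = ((2 * (α * ⟪adjoint W₁ (Binv x₀), adjoint W₀ (Binv x₀)⟫_ℂ).re : ℝ) : ℂ) := by
  rw [eq28_pairing Binv hB, ← map_mul, Complex.add_conj]

/-- **(29), the pairing** (`u = z = [ ]⁻¹x₀`, so `Binv u = [ ]⁻²x₀` and `W₀†(Binv u) = (b_m)`):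
`⟨[ ]⁻¹B[ ]⁻¹x₀, [ ]⁻¹x₀⟩ = α⟪W₁†([ ]⁻²x₀), W₀†z⟫ + ᾱ⟪W₀†([ ]⁻²x₀), W₁†z⟫` (paper: `α Σ a_m b̄_{m+j} + ᾱ Σ a_{m+j} b̄_m`;
(29) is minus this, the first-order `⟨ch [ ]⁻¹x₀, [ ]⁻¹x₀⟩` of (31)/(32)). [cite: Enflo2023, v2 (28)–(30), p.15] -/
theorem eq29_pairing (Binv : H →L[ℂ] H) (hB : IsSelfAdjoint Binv) (W₀ W₁ : E →L[ℂ] H) (x₀ : H) (α : ℂ) :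
    ⟪Binv x₀, Binv ((α • (W₁ ∘L adjoint W₀) + conj α • (W₀ ∘L adjoint W₁)) (Binv x₀))⟫_ℂ
      = α * ⟪adjoint W₁ (Binv (Binv x₀)), adjoint W₀ (Binv x₀)⟫_ℂ
        + conj α * ⟪adjoint W₀ (Binv (Binv x₀)), adjoint W₁ (Binv x₀)⟫_ℂ :=
  firstOrder_pairing Binv hB W₀ W₁ x₀ (Binv x₀) α

/-- **(30), EXACT expansion** of the `a₀`-coefficient `⟨[ ]⁻¹x₀, y⟩` when `[ ]⁻¹x₀` is replaced by its first-order
value `z − [ ]⁻¹Bz` AND `y` by `y + αy₁` (`y₁ = T^jy`): the four terms of (30) — `⟨z,y⟩`, `ᾱ⟨z,y₁⟩ = ᾱ a_j`,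
`−(α Σ a_m κ̄_{m+j} + ᾱ Σ_{m≥0} a_{m+j} κ̄_m)` (pairing with `u = y`, `W₀†([ ]⁻¹y) = (κ_m)`; the paper merges the `m = 0`
term `ᾱ a_j κ̄₀` into `ᾱ a_j(1 − κ₀)`) — plus the ONE second-order cross term `−ᾱ·⟪y₁, [ ]⁻¹Bz⟫`, displayed. [cite: Enflo2023, v2 (28)–(30), p.15] -/
theorem eq30_expansion (Binv : H →L[ℂ] H) (hB : IsSelfAdjoint Binv) (W₀ W₁ : E →L[ℂ] H) (x₀ y y₁ : H) (α : ℂ) :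
    ⟪y + α • y₁, Binv x₀ - Binv ((α • (W₁ ∘L adjoint W₀) + conj α • (W₀ ∘L adjoint W₁)) (Binv x₀))⟫_ℂ
      = ⟪y, Binv x₀⟫_ℂ + conj α * ⟪y₁, Binv x₀⟫_ℂ
        - (α * ⟪adjoint W₁ (Binv y), adjoint W₀ (Binv x₀)⟫_ℂ
            + conj α * ⟪adjoint W₀ (Binv y), adjoint W₁ (Binv x₀)⟫_ℂ)
        - conj α * ⟪y₁, Binv ((α • (W₁ ∘L adjoint W₀) + conj α • (W₀ ∘L adjoint W₁)) (Binv x₀))⟫_ℂ := by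
  rw [inner_sub_right, inner_add_left, inner_add_left, inner_smul_left, inner_smul_left,
    firstOrder_pairing Binv hB W₀ W₁ x₀ y α]
  ring

/-- tex L435, the pairing for the scaling step: `⟨[ ]⁻¹(2δWW†)[ ]⁻¹x₀, x₀⟩ = 2δ‖W†z‖²` (= `2δ Σ_m|a_m|²`). [cite: Enflo2023, v2 (28)–(30), p.15] -/
theorem scaling_pairing (Binv : H →L[ℂ] H) (hB : IsSelfAdjoint Binv) (W₀ : E →L[ℂ] H) (x₀ : H) (δ : ℝ) :
    ⟪x₀, Binv ((((2 * δ : ℝ) : ℂ) • (W₀ ∘L adjoint W₀)) (Binv x₀))⟫_ℂ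
      = ((2 * δ : ℝ) : ℂ) * ((‖adjoint W₀ (Binv x₀)‖ : ℂ) ^ 2) := by
  have hsa : ∀ u, ⟪x₀, Binv u⟫_ℂ = ⟪Binv x₀, u⟫_ℂ := fun u => by
    rw [← adjoint_inner_left, hB.adjoint_eq]
  rw [hsa]
  simp only [_root_.smul_apply, ContinuousLinearMap.comp_apply, inner_smul_right]
  rw [← adjoint_inner_left W₀, inner_self_eq_norm_sq_to_K]
  rfl

/-- `I + WW†` is self-adjoint. [folklore] -/
theorem isSelfAdjoint_one_add_comp_adjoint (W₀ : E →L[ℂ] H) : IsSelfAdjoint (1 + W₀ ∘L adjoint W₀) := by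
  have h1 : IsSelfAdjoint (W₀ ∘L adjoint W₀) := by
    unfold IsSelfAdjoint
    rw [star_eq_adjoint, adjoint_comp, adjoint_adjoint]
  exact (IsSelfAdjoint.one _).add h1

/-- **(28) assembled**: `[ ] = I + WW†` is a unit; the Fréchet derivative `D` of `S ↦ ⟨S⁻¹x₀, x₀⟩` at `[ ]`
(FirstOrder.lean) evaluated on the exact first-order term `B = αW₁W† + ᾱWW₁†` of `(W+αW₁)(W+αW₁)†` is
`−(α s + ᾱ s̄)`, `s = ⟪W₁†z, W†z⟫`, `z = [ ]⁻¹x₀`. [cite: Enflo2023, v2 (28)–(30), p.15] -/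
theorem eq28 (W₀ W₁ : E →L[ℂ] H) (x₀ : H) (α : ℂ)
    (hP : (W₀ ∘L adjoint W₀).IsPositive) :
    ∃ (A : (H →L[ℂ] H)ˣ) (D : (H →L[ℂ] H) →L[ℂ] ℂ),
      (A : H →L[ℂ] H) = 1 + W₀ ∘L adjoint W₀ ∧
      HasFDerivAt (fun S : H →L[ℂ] H => ⟪x₀, (Ring.inverse S) x₀⟫_ℂ) D (A : H →L[ℂ] H) ∧
      D (α • (W₁ ∘L adjoint W₀) + conj α • (W₀ ∘L adjoint W₁))
        = -(α * ⟪adjoint W₁ ((↑A⁻¹ : H →L[ℂ] H) x₀), adjoint W₀ ((↑A⁻¹ : H →L[ℂ] H) x₀)⟫_ℂ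
            + conj α * conj ⟪adjoint W₁ ((↑A⁻¹ : H →L[ℂ] H) x₀), adjoint W₀ ((↑A⁻¹ : H →L[ℂ] H) x₀)⟫_ℂ) := by
  obtain ⟨A, hA⟩ := isUnit_one_add_of_isPositive (W₀ ∘L adjoint W₀) hP
  obtain ⟨D, hD, hDB⟩ := firstOrder_inner_inverse A x₀
  refine ⟨A, D, hA, hD, ?_⟩
  have hsa : IsSelfAdjoint ((↑A⁻¹ : H →L[ℂ] H)) := by
    have : IsSelfAdjoint (A : H →L[ℂ] H) := by rw [hA]; exact isSelfAdjoint_one_add_comp_adjoint W₀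
    have h2 := this.ringInverse  -- Mathlib `IsSelfAdjoint.ringInverse`
    rwa [Ring.inverse_unit] at h2
  rw [hDB, eq28_pairing _ hsa]

/-- `WW†` is positive (Mathlib), so `eq28` applies with `W = V_y` unconditionally. [folklore] -/
theorem isPositive_comp_adjoint (W₀ : E →L[ℂ] H) : (W₀ ∘L adjoint W₀).IsPositive :=
  ContinuousLinearMap.isPositive_self_comp_adjoint W₀

end Literature.Analysis.OperatorTheory.Enflo2023
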